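import Mathlib
import HarnessLib
import Literature.Probability.MarkovChains.SeparationDistance
import Literature.Probability.MarkovChains.SpectralMixingTimeBound

/-!
# `ℓ^p` distances: `2d(t) ≤ d⁽²⁾(t) ≤ d⁽∞⁾(t)` and Proposition 4.15 `d⁽∞⁾(2t) = [d⁽²⁾(t)]² = max_x q_{2t}(x,x) − 1` (Levin–Peres–Wilmer §4.7)

HONEST FRAMING: exact (Metropolis-corrected) sampling algorithms for lattice gauge theory; figures
of merit are autocorrelation/cost numbers at stated couplings and volumes; no continuum-physics claim.

Conventions of `TotalVariation.lean` (`tvDist`, `IsRowStochastic`), `MetropolisHastings.lean`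
(`DetailedBalance`), `PeskunOrdering.lean` (`piInner π g h = ⟨g,h⟩_π = Σ_x π(x)g(x)h(x)`),
`MixingTimeSubmultiplicative.lean` / `BottleneckRatio.lean` (`kernelAt P t x y = Pᵗ(x,y)`,
`worstTvDist P π t = d(t)`), `SpectralMixingTimeBound.lean` (`4‖μ − π‖²_TV ≤ ‖μ/π − 1‖²₂`) and
`SeparationDistance.lean` (`DetailedBalance.kernelAt`).  Source: D. A. Levin, Y. Peres (with
E. L. Wilmer), *Markov Chains and Mixing Times*, 2nd ed., AMS 2017 [LevinPeres2017], §4.7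
"`ℓ^p` distance and mixing", pp. 56–57, eqs. (4.35)–(4.43) and Proposition 4.15.  Everything is
PROVED (finite sums; 0 named facts).  NOT here: submultiplicativity of `d⁽ᵖ⁾` (Lemma 4.18) and
the `ℓ^p` mixing times (4.44).

* `relDensity P π t x y` — **`q_t(x,y) = Pᵗ(x,y)/π(y)`** [cite: LevinPeres2017, §4.7 (definition of
  `q_t`)]; `sum_relDensity_mul` — **eq. (4.35)** `⟨q_t(x,·), 1⟩_π = 1`; `relDensity_comm` —
  `q_t(x,y) = q_t(y,x)` for a reversible chain [cite: LevinPeres2017, §4.7 ("note that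
  `q_t(x,y) = q_t(y,x)` when `P` is reversible with respect to `π`"), eq. (4.35)];
* `lTwoDist P π t` — **`d⁽²⁾(t) = max_x ‖q_t(x,·) − 1‖₂`** and `lInfDist P π t` — **`d⁽∞⁾(t) =
  max_x ‖q_t(x,·) − 1‖_∞`** [cite: LevinPeres2017, §4.7 eq. (4.36) (`p = 2, ∞`)];
* **eq. (4.37)** `two_mul_worstTvDist_le_lTwoDist` (`2d(t) ≤ d⁽²⁾(t)`) and `lTwoDist_le_lInfDist`
  (`d⁽²⁾(t) ≤ d⁽∞⁾(t)`) [cite: LevinPeres2017, §4.7 eq. (4.37)];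
* **eqs. (4.39)–(4.42)** `LevinPeres2017_eq_4_39` (`q_{2t}(x,y) = ⟨q_t(x,·), q_t(y,·)⟩_π`),
  `LevinPeres2017_eq_4_40` (`⟨q_t(x,·) − 1, q_t(y,·) − 1⟩_π = q_{2t}(x,y) − 1`), `LevinPeres2017_eq_4_41`
  (`‖q_t(x,·) − 1‖²₂ = q_{2t}(x,x) − 1`), `LevinPeres2017_eq_4_42` (`|q_{2t}(x,y) − 1| ≤
  √(q_{2t}(x,x) − 1) √(q_{2t}(y,y) − 1)`, Cauchy–Schwarz `piInner_sq_le_mul`) — reversible `P`,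
  positive `π` [cite: LevinPeres2017, §4.7, proof of Prop. 4.15, eqs. (4.39)–(4.42)];
* **PROPOSITION 4.15** `LevinPeres2017_prop_4_15` — for a reversible Markov chain
  **`d⁽∞⁾(2t) = [d⁽²⁾(t)]² = max_x q_{2t}(x,x) − 1`** [cite: LevinPeres2017, §4.7 Prop. 4.15
  eq. (4.38)].

Context (cell pub-lqcd, venture LatticeQCDFlow): `q_{2t}(x,x) − 1 = ‖q_t(x,·) − 1‖²₂` is the
"return-probability" diagnostic of a reversible sampler — a single diagonal entry of `P^{2t}` controls
the uniform (`ℓ^∞`) distance at time `2t` and, by (4.37), the total variation distance at time `t`.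
-/

namespace Literature.Probability.MarkovChains

open Finset Matrix

variable {X : Type*} [Fintype X] [DecidableEq X]

/-! ## `q_t`, `d⁽²⁾`, `d⁽∞⁾` -/

/-- **`q_t(x,y) := Pᵗ(x,y)/π(y)`**, the density of `Pᵗ(x,·)` with respect to `π`.
[cite: LevinPeres2017, §4.7 (definition of `q_t(x,y)`)] -/
noncomputable def relDensity (P : X → X → ℝ) (π : X → ℝ) (t : ℕ) (x y : X) : ℝ :=
  kernelAt P t x y / π y

/-- **`d⁽²⁾(t) = max_x ‖q_t(x,·) − 1‖₂`**, `‖f‖₂ = (Σ_y f(y)²π(y))^{1/2}` (as `⨆` over the finite `X`).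
[cite: LevinPeres2017, §4.7 eq. (4.36) (`p = 2`)] -/
noncomputable def lTwoDist (P : X → X → ℝ) (π : X → ℝ) (t : ℕ) : ℝ :=
  ⨆ x : X, Real.sqrt (piInner π (fun y => relDensity P π t x y - 1) (fun y => relDensity P π t x y - 1))

/-- **`d⁽∞⁾(t) = max_x ‖q_t(x,·) − 1‖_∞ = max_{x,y} |q_t(x,y) − 1|`**.
[cite: LevinPeres2017, §4.7 eq. (4.36) (`p = ∞`)] -/
noncomputable def lInfDist (P : X → X → ℝ) (π : X → ℝ) (t : ℕ) : ℝ :=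
  ⨆ x : X, ⨆ y : X, |relDensity P π t x y - 1|

variable {P : Matrix X X ℝ} {π : X → ℝ}

/-- `q_t` unfolded. [cite: LevinPeres2017, §4.7 (definition of `q_t`)] -/
theorem relDensity_apply (P : X → X → ℝ) (π : X → ℝ) (t : ℕ) (x y : X) :
    relDensity P π t x y = kernelAt P t x y / π y := rfl

/-- **Eq. (4.35)**: `⟨q_t(x,·), 1⟩_π = Σ_y q_t(x,y)π(y) = 1` (positive `π`).
[cite: LevinPeres2017, §4.7 eq. (4.35)] -/
theorem sum_relDensity_mul (hP : IsRowStochastic P) (hπ : ∀ y, 0 < π y) (t : ℕ) (x : X) :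
    ∑ y, relDensity P π t x y * π y = 1 := by
  simp_rw [relDensity_apply, div_mul_cancel₀ _ (hπ _).ne']
  exact sum_kernelAt hP t x

/-- For a reversible chain `q_t(x,y) = q_t(y,x)`. [cite: LevinPeres2017, §4.7 ("note that
`q_t(x,y) = q_t(y,x)` when `P` is reversible with respect to `π`")] -/
theorem relDensity_comm (hDB : DetailedBalance π P) (hπ : ∀ y, 0 < π y) (t : ℕ) (x y : X) :
    relDensity P π t x y = relDensity P π t y x := by
  rw [relDensity_apply, relDensity_apply, div_eq_div_iff (hπ y).ne' (hπ x).ne', mul_comm _ (π x),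
    mul_comm _ (π y)]
  exact hDB.kernelAt t x y

/-- Chapman–Kolmogorov at the midpoint: `P^{2t}(x,y) = Σ_z Pᵗ(x,z)Pᵗ(z,y)`. [cite: LevinPeres2017,
§4.7, proof of Prop. 4.15 ("First observe that `P^{2t}(x,y) = Σ_z Pᵗ(x,z)Pᵗ(z,y)`")] -/
theorem kernelAt_two_mul (P : Matrix X X ℝ) (t : ℕ) (x y : X) :
    kernelAt P (2 * t) x y = ∑ z, kernelAt P t x z * kernelAt P t z y := by
  rw [two_mul, kernelAt_eq_pow_apply, pow_add, mul_apply]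
  simp_rw [← kernelAt_eq_pow_apply]

/-! ## Eqs. (4.39)–(4.42) -/

/-- **Eq. (4.39)**: for a reversible chain, `q_{2t}(x,y) = Σ_z [Pᵗ(x,z)/π(z)][Pᵗ(z,y)/π(y)]π(z) =
⟨q_t(x,·), q_t(y,·)⟩_π`. [cite: LevinPeres2017, §4.7, proof of Prop. 4.15, eq. (4.39)] -/
theorem LevinPeres2017_eq_4_39 (hDB : DetailedBalance π P) (hπ : ∀ y, 0 < π y) (t : ℕ) (x y : X) :
    relDensity P π (2 * t) x y = piInner π (relDensity P π t x) (relDensity P π t y) := by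
  unfold piInner
  rw [relDensity_apply, kernelAt_two_mul, sum_div]
  refine sum_congr rfl fun z _ => ?_
  rw [relDensity_comm hDB hπ t y z, relDensity_apply, relDensity_apply]
  have hz : π z ≠ 0 := (hπ z).ne'
  have hy : π y ≠ 0 := (hπ y).ne'
  field_simp

/-- **Eq. (4.40)**: `⟨q_t(x,·) − 1, q_t(y,·) − 1⟩_π = q_{2t}(x,y) − 1` (expand and use (4.35), (4.39)).
[cite: LevinPeres2017, §4.7, proof of Prop. 4.15, eq. (4.40)] -/
theorem LevinPeres2017_eq_4_40 (hP : IsRowStochastic P) (hDB : DetailedBalance π P)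
    (hπ : ∀ y, 0 < π y) (hπ1 : ∑ y, π y = 1) (t : ℕ) (x y : X) :
    piInner π (fun z => relDensity P π t x z - 1) (fun z => relDensity P π t y z - 1) =
      relDensity P π (2 * t) x y - 1 := by
  rw [LevinPeres2017_eq_4_39 hDB hπ t x y]
  unfold piInner
  have hx1 := sum_relDensity_mul hP hπ t x
  have hy1 := sum_relDensity_mul hP hπ t y
  have hexp : ∀ z, π z * ((relDensity P π t x z - 1) * (relDensity P π t y z - 1)) =
      π z * (relDensity P π t x z * relDensity P π t y z) - relDensity P π t x z * π z -
        relDensity P π t y z * π z + π z := fun z => by ring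
  simp_rw [hexp]
  rw [sum_add_distrib, sum_sub_distrib, sum_sub_distrib, hx1, hy1, hπ1]
  ring

/-- **Eq. (4.41)**: `‖q_t(x,·) − 1‖²₂ = q_{2t}(x,x) − 1`. [cite: LevinPeres2017, §4.7, proof of
Prop. 4.15, eq. (4.41)] -/
theorem LevinPeres2017_eq_4_41 (hP : IsRowStochastic P) (hDB : DetailedBalance π P)
    (hπ : ∀ y, 0 < π y) (hπ1 : ∑ y, π y = 1) (t : ℕ) (x : X) :
    piInner π (fun z => relDensity P π t x z - 1) (fun z => relDensity P π t x z - 1) =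
      relDensity P π (2 * t) x x - 1 :=
  LevinPeres2017_eq_4_40 hP hDB hπ hπ1 t x x

omit [DecidableEq X] in
/-- **Cauchy–Schwarz for `⟨·,·⟩_π`**: `⟨g,h⟩_π² ≤ ⟨g,g⟩_π ⟨h,h⟩_π` (`π ≥ 0`). [cite: LevinPeres2017,
§4.7, proof of Prop. 4.15 ("By (4.40) and Cauchy-Schwarz")] -/
theorem piInner_sq_le_mul (hπ0 : ∀ y, 0 ≤ π y) (g h : X → ℝ) :
    piInner π g h ^ 2 ≤ piInner π g g * piInner π h h := by
  have hcs := sum_mul_sq_le_sq_mul_sq univ (fun z => Real.sqrt (π z) * g z) (fun z => Real.sqrt (π z) * h z)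
  have h1 : ∀ z, Real.sqrt (π z) * g z * (Real.sqrt (π z) * h z) = π z * (g z * h z) := fun z => by
    have := Real.mul_self_sqrt (hπ0 z)
    linear_combination (g z * h z) * this
  have h2 : ∀ f : X → ℝ, ∀ z, (Real.sqrt (π z) * f z) ^ 2 = π z * (f z * f z) := fun f z => by
    rw [mul_pow, Real.sq_sqrt (hπ0 z)]
    ring
  simp_rw [h1, h2] at hcs
  exact hcs

omit [DecidableEq X] in
/-- `⟨g,g⟩_π ≥ 0` for `π ≥ 0` (so `‖q_t(x,·) − 1‖²₂ ≥ 0`, i.e. `q_{2t}(x,x) ≥ 1` for a reversible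
chain). [cite: LevinPeres2017, §4.7 eq. (4.41)] -/
theorem piInner_self_nonneg (hπ0 : ∀ y, 0 ≤ π y) (g : X → ℝ) : 0 ≤ piInner π g g :=
  sum_nonneg fun z _ => mul_nonneg (hπ0 z) (mul_self_nonneg (g z))

/-- **Eq. (4.42)**: `|q_{2t}(x,y) − 1| ≤ ‖q_t(x,·) − 1‖₂ ‖q_t(y,·) − 1‖₂ =
√(q_{2t}(x,x) − 1) √(q_{2t}(y,y) − 1)`. [cite: LevinPeres2017, §4.7, proof of Prop. 4.15,
eq. (4.42)] -/
theorem LevinPeres2017_eq_4_42 (hP : IsRowStochastic P) (hDB : DetailedBalance π P)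
    (hπ : ∀ y, 0 < π y) (hπ1 : ∑ y, π y = 1) (t : ℕ) (x y : X) :
    |relDensity P π (2 * t) x y - 1| ≤
      Real.sqrt (relDensity P π (2 * t) x x - 1) * Real.sqrt (relDensity P π (2 * t) y y - 1) := by
  have hπ0 : ∀ z, 0 ≤ π z := fun z => (hπ z).le
  rw [← LevinPeres2017_eq_4_40 hP hDB hπ hπ1 t x y, ← LevinPeres2017_eq_4_41 hP hDB hπ hπ1 t x,
    ← LevinPeres2017_eq_4_41 hP hDB hπ hπ1 t y, ← Real.sqrt_mul (piInner_self_nonneg hπ0 _),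
    ← Real.sqrt_sq_eq_abs]
  exact Real.sqrt_le_sqrt (piInner_sq_le_mul hπ0 _ _)

/-! ## Eq. (4.37): `2d(t) ≤ d⁽²⁾(t) ≤ d⁽∞⁾(t)` -/

/-- `‖q_t(x,·) − 1‖₂ ≤ d⁽²⁾(t)`. [cite: LevinPeres2017, §4.7 eq. (4.36)] -/
theorem norm_le_lTwoDist (P : X → X → ℝ) (π : X → ℝ) (t : ℕ) (x : X) :
    Real.sqrt (piInner π (fun y => relDensity P π t x y - 1) (fun y => relDensity P π t x y - 1)) ≤
      lTwoDist P π t :=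
  le_ciSup (f := fun x => Real.sqrt
    (piInner π (fun y => relDensity P π t x y - 1) (fun y => relDensity P π t x y - 1)))
    (Set.finite_range _).bddAbove x

/-- `|q_t(x,y) − 1| ≤ d⁽∞⁾(t)`. [cite: LevinPeres2017, §4.7 eq. (4.36)] -/
theorem abs_sub_one_le_lInfDist (P : X → X → ℝ) (π : X → ℝ) (t : ℕ) (x y : X) :
    |relDensity P π t x y - 1| ≤ lInfDist P π t :=
  (le_ciSup (f := fun y => |relDensity P π t x y - 1|) (Set.finite_range _).bddAbove y).trans
    (le_ciSup (f := fun x => ⨆ y : X, |relDensity P π t x y - 1|) (Set.finite_range _).bddAbove x)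

/-- `d⁽²⁾(t) ≥ 0`, `d⁽∞⁾(t) ≥ 0`. [cite: LevinPeres2017, §4.7 eq. (4.36)] -/
theorem lTwoDist_nonneg (P : X → X → ℝ) (π : X → ℝ) (t : ℕ) : 0 ≤ lTwoDist P π t :=
  Real.iSup_nonneg fun _ => Real.sqrt_nonneg _

/-- `d⁽∞⁾(t) ≥ 0`. [cite: LevinPeres2017, §4.7 eq. (4.36)] -/
theorem lInfDist_nonneg (P : X → X → ℝ) (π : X → ℝ) (t : ℕ) : 0 ≤ lInfDist P π t :=
  Real.iSup_nonneg fun _ => Real.iSup_nonneg fun _ => abs_nonneg _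

/-- **Eq. (4.37), first inequality: `2d(t) ≤ d⁽²⁾(t)`** (`2‖μ − π‖_TV = ‖μ/π − 1‖₁ ≤ ‖μ/π − 1‖₂`,
positive `π`). [cite: LevinPeres2017, §4.7 eq. (4.37) (Proposition 4.2 and Exercise 4.5)] -/
theorem two_mul_worstTvDist_le_lTwoDist (hπ : ∀ y, 0 < π y) (hπ1 : ∑ y, π y = 1) (t : ℕ) :
    2 * worstTvDist P π t ≤ lTwoDist P π t := by
  have h0 := lTwoDist_nonneg (P : X → X → ℝ) π t
  rcases isEmpty_or_nonempty X with hX | hX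
  · simp [worstTvDist, lTwoDist]
  · rw [mul_comm, ← le_div_iff₀ (by norm_num : (0 : ℝ) < 2)]
    refine ciSup_le fun x => ?_
    rw [le_div_iff₀ (by norm_num : (0 : ℝ) < 2), mul_comm]
    have h4 := four_mul_tvDist_sq_le_piInner hπ hπ1 (lawAt P (Pi.single x 1) t)
    have htv := tvDist_nonneg (lawAt P (Pi.single x 1) t) π
    calc 2 * tvDist (lawAt P (Pi.single x 1) t) π
        = Real.sqrt ((2 * tvDist (lawAt P (Pi.single x 1) t) π) ^ 2) :=
          (Real.sqrt_sq (by positivity)).symm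
      _ ≤ Real.sqrt (piInner π (fun y => relDensity P π t x y - 1)
            (fun y => relDensity P π t x y - 1)) :=
          Real.sqrt_le_sqrt (by rw [mul_pow]; norm_num; exact h4)
      _ ≤ lTwoDist P π t := norm_le_lTwoDist P π t x

/-- **Eq. (4.37), second inequality: `d⁽²⁾(t) ≤ d⁽∞⁾(t)`** (`‖f‖₂ ≤ ‖f‖_∞` under a probability
vector `π`). [cite: LevinPeres2017, §4.7 eq. (4.37) (Exercise 4.5: the `ℓ^p` norms are
non-decreasing)] -/
theorem lTwoDist_le_lInfDist (hπ0 : ∀ y, 0 ≤ π y) (hπ1 : ∑ y, π y = 1) (t : ℕ) :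
    lTwoDist P π t ≤ lInfDist P π t := by
  have h0 := lInfDist_nonneg (P : X → X → ℝ) π t
  refine Real.iSup_le (fun x => ?_) h0
  rw [← Real.sqrt_sq h0]
  refine Real.sqrt_le_sqrt ?_
  unfold piInner
  calc ∑ y, π y * ((relDensity P π t x y - 1) * (relDensity P π t x y - 1))
      ≤ ∑ y, π y * lInfDist P π t ^ 2 := by
        refine sum_le_sum fun y _ => mul_le_mul_of_nonneg_left ?_ (hπ0 y)
        rw [← abs_mul_abs_self, sq]
        have := abs_sub_one_le_lInfDist (P : X → X → ℝ) π t x y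
        exact mul_le_mul this this (abs_nonneg _) h0
    _ = lInfDist P π t ^ 2 := by rw [← sum_mul, hπ1, one_mul]

/-! ## Proposition 4.15 -/

/-- **PROPOSITION 4.15**: for a reversible Markov chain (positive `π` in detailed balance with `P`),
**`d⁽∞⁾(2t) = [d⁽²⁾(t)]² = max_x q_{2t}(x,x) − 1`**.  As printed: (4.41) maximised over `x` gives the
right-hand equality; (4.42) gives `d⁽∞⁾(2t) ≤ max_x q_{2t}(x,x) − 1` (4.43), with equality at `x = y`.
[cite: LevinPeres2017, §4.7 Prop. 4.15 eq. (4.38)] -/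
theorem LevinPeres2017_prop_4_15 (hP : IsRowStochastic P) (hDB : DetailedBalance π P)
    (hπ : ∀ y, 0 < π y) (hπ1 : ∑ y, π y = 1) (t : ℕ) :
    lInfDist P π (2 * t) = lTwoDist P π t ^ 2 ∧
      lTwoDist P π t ^ 2 = ⨆ x : X, (relDensity P π (2 * t) x x - 1) := by
  have hπ0 : ∀ z, 0 ≤ π z := fun z => (hπ z).le
  obtain ⟨x₁, -, -⟩ := Finset.exists_ne_zero_of_sum_ne_zero
    (s := (univ : Finset X)) (f := π) (by rw [hπ1]; exact one_ne_zero)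
  haveI : Nonempty X := ⟨x₁⟩
  -- abbreviations: `a x = q_{2t}(x,x) − 1 = ‖q_t(x,·) − 1‖²₂ ≥ 0`, `M = max_x a x`
  set a : X → ℝ := fun x => relDensity P π (2 * t) x x - 1 with ha
  have ha0 : ∀ x, 0 ≤ a x := fun x => by
    rw [ha]
    simp only
    rw [← LevinPeres2017_eq_4_41 hP hDB hπ hπ1 t x]
    exact piInner_self_nonneg hπ0 _
  have hbdd : BddAbove (Set.range a) := (Set.finite_range a).bddAbove
  obtain ⟨x₀, hx₀⟩ := exists_eq_ciSup_of_finite (f := a)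
  have hM0 : 0 ≤ ⨆ x, a x := (ha0 x₀).trans_eq hx₀
  -- `d⁽²⁾(t) = √M`
  have h2 : lTwoDist P π t = Real.sqrt (⨆ x, a x) := by
    unfold lTwoDist
    simp_rw [LevinPeres2017_eq_4_41 hP hDB hπ hπ1 t]
    refine le_antisymm (ciSup_le fun x => Real.sqrt_le_sqrt (le_ciSup hbdd x)) ?_
    rw [← hx₀]
    exact le_ciSup (f := fun x => Real.sqrt (a x)) (Set.finite_range _).bddAbove x₀
  have h2sq : lTwoDist P π t ^ 2 = ⨆ x, a x := by
    rw [h2, Real.sq_sqrt hM0]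
  refine ⟨?_, h2sq⟩
  rw [h2sq]
  -- `d⁽∞⁾(2t) = M`: `≤` by (4.42), `≥` at `x = y = x₀`
  refine le_antisymm ?_ ?_
  · refine ciSup_le fun x => ciSup_le fun y => ?_
    calc |relDensity P π (2 * t) x y - 1|
        ≤ Real.sqrt (a x) * Real.sqrt (a y) := LevinPeres2017_eq_4_42 hP hDB hπ hπ1 t x y
      _ ≤ Real.sqrt (⨆ x, a x) * Real.sqrt (⨆ x, a x) :=
          mul_le_mul (Real.sqrt_le_sqrt (le_ciSup hbdd x)) (Real.sqrt_le_sqrt (le_ciSup hbdd y))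
            (Real.sqrt_nonneg _) (Real.sqrt_nonneg _)
      _ = ⨆ x, a x := Real.mul_self_sqrt hM0
  · calc (⨆ x, a x) = a x₀ := hx₀.symm
      _ = |relDensity P π (2 * t) x₀ x₀ - 1| := (abs_of_nonneg (ha0 x₀)).symm
      _ ≤ lInfDist P π (2 * t) := abs_sub_one_le_lInfDist P π (2 * t) x₀ x₀

end Literature.Probability.MarkovChains
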